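import Mathlib.Analysis.Calculus.ParametricIntegral
import Mathlib.MeasureTheory.Integral.Bochner.ContinuousLinearMap
import Literature.Analysis.Complex.SeveralVariables
import Literature.Analysis.Distribution.FourierLaplaceTransform
import HarnessLib

/-!
# Tubes over open cones in `ℂ^ι`: complex rays and the smeared ray function

Topic `Literature/MathematicalPhysics/QuantumLattice` (trunk T-AQFT). Support file for the **local**
uniqueness theorem for distributional boundary values on a tube (Streater–Wightman (1964),
Thm. 2-17, local form: a function holomorphic in `ℝ^ι + iC` whose boundary values vanish on an
open real set vanishes identically), `TubeBoundaryValueLocal.lean`, which in turn serves the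
Jost–Schroer theorem (`Literature.Barriers.QuantumFields.JostSchroerCommutator`, S–W Thm 4-15) and
the bounded form of S–W Thm 4-3. The sibling `SchwingerWightmanBoundaryValueProofs` treats the
forward tube `𝒯ₙ` of configurations `(ℝ^{1+d})ⁿ` with *global* vanishing; here the tube is
`tubeOver C = {z ∈ ℂ^ι | Im z ∈ C}` for an arbitrary open cone `C ⊆ ℝ^ι = EuclideanSpace ℝ ι`, the
format of the tree's Fourier–Laplace theorem `Literature.Analysis.Distribution.fourierLaplace_coneSupport`
(tube `{Im z ∈ interior S⁻}`, rays `rayPoint x y t = x + ity`).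

Contents (all folklore bookkeeping, adapted from the sibling file):

* `tubeOver C`, open for open `C`, convex for convex `C`;
* the complex ray `cray x y λ = x + λy` (`cray x y (ti) = rayPoint x y t`), its membership in the
  tube for `Im λ > 0` and `y ∈ C` (`C` a cone), continuity, derivative, the splitting
  `x + (s + it)y = (x + sy) + ity`, and `z = cray (Re z) (Im z) i`;
* bounds of continuous functions on compact families of rays (`exists_bound_cray`);
* **holomorphy of the smeared ray function** `λ ↦ ∫ F(x + λy) φ(x) dx` on `Im λ > 0` for `F`
  holomorphic on the tube and `φ` continuous of compact support (`differentiableAt_integral_cray`;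
  Hörmander, proof of Thm. 3.1.15), by differentiation under the integral sign, the derivative of
  `F` being continuous (`Literature.Analysis.Complex.SCV.continuousOn_fderiv`).

## References

* R. F. Streater, A. S. Wightman, *PCT, Spin and Statistics, and All That* (1964), Thm. 2-17.
  [StreaterWightman1964]
* L. Hörmander, *The Analysis of Linear Partial Differential Operators I*, Thm. 3.1.15.
  [HormanderALPDO1]
-/

noncomputable section

open Filter MeasureTheory Set
open _root_.Complex
open _root_.Topology
open scoped ContDiff
open Literature.Analysis.Distribution

namespace Literature.MathematicalPhysics.QuantumLattice

variable {ι : Type*}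

/-! ### Real parts, tubes over cones -/

/-- The real part of `z ∈ ℂ^ι` as a point of `ℝ^ι` (companion of
`Literature.Analysis.Distribution.imVec`). [folklore] -/
def reVec (z : ι → ℂ) : EuclideanSpace ℝ ι := WithLp.toLp 2 fun i => (z i).re

/-- Components of `reVec`. [folklore] -/
@[simp]
theorem reVec_apply (z : ι → ℂ) (i : ι) : reVec z i = (z i).re := rfl

/-- **The tube over a set of imaginary parts**: `tubeOver C = {z ∈ ℂ^ι | Im z ∈ C}`
(Streater–Wightman (1964), §2-3: the tube `ℝⁿ + iC` over the cone `C`; for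
`C = interior S⁻` this is the domain of holomorphy of the Fourier–Laplace transform,
`Literature.Analysis.Distribution.fourierLaplace_coneSupport`). [cite: StreaterWightman1964, Thm 2-6] -/
def tubeOver (C : Set (EuclideanSpace ℝ ι)) : Set (ι → ℂ) := {z | imVec z ∈ C}

/-- Membership in the tube. [folklore] -/
theorem mem_tubeOver_iff {C : Set (EuclideanSpace ℝ ι)} {z : ι → ℂ} :
    z ∈ tubeOver C ↔ imVec z ∈ C := Iff.rfl

/-- `imVec` is continuous. [folklore] -/
theorem continuous_imVec : Continuous (imVec : (ι → ℂ) → EuclideanSpace ℝ ι) :=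
  (PiLp.continuous_toLp 2 _).comp
    (continuous_pi fun i => continuous_im.comp (continuous_apply i))

/-- `reVec` is continuous. [folklore] -/
theorem continuous_reVec : Continuous (reVec : (ι → ℂ) → EuclideanSpace ℝ ι) :=
  (PiLp.continuous_toLp 2 _).comp
    (continuous_pi fun i => continuous_re.comp (continuous_apply i))

/-- `imVec` is real-linear: compatibility with real scalars. [folklore] -/
theorem imVec_real_smul (a : ℝ) (z : ι → ℂ) : imVec ((a : ℂ) • z) = a • imVec z := by
  ext i; simp

/-- The tube over an open set is open. [folklore] -/
theorem isOpen_tubeOver {C : Set (EuclideanSpace ℝ ι)} (hC : IsOpen C) : IsOpen (tubeOver C) :=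
  hC.preimage continuous_imVec

/-- The tube over a convex set is convex. [folklore] -/
theorem convex_tubeOver {C : Set (EuclideanSpace ℝ ι)} (hC : Convex ℝ C) : Convex ℝ (tubeOver C) := by
  intro z hz w hw a b ha hb hab
  rw [mem_tubeOver_iff] at hz hw ⊢
  have h : imVec (a • z + b • w) = a • imVec z + b • imVec w := by
    ext i; simp
  rw [h]
  exact hC hz hw ha hb hab

/-! ### Complex rays -/

/-- The complex ray `x + λ y` through the real point `x` in the real direction `y`; for `λ = it`
this is the ray `rayPoint x y t` of `fourierLaplace_coneSupport`. [folklore] -/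
def cray (x y : EuclideanSpace ℝ ι) (l : ℂ) : ι → ℂ := fun i => (x i : ℂ) + l * (y i : ℂ)

/-- Components of the complex ray. [folklore] -/
@[simp]
theorem cray_apply (x y : EuclideanSpace ℝ ι) (l : ℂ) (i : ι) :
    cray x y l i = (x i : ℂ) + l * (y i : ℂ) := rfl

/-- `cray x y (it) = rayPoint x y t`. [folklore] -/
theorem cray_ofReal_mul_I (x y : EuclideanSpace ℝ ι) (t : ℝ) :
    cray x y ((t : ℂ) * I) = rayPoint x y t := rfl

/-- The imaginary part along the complex ray is `Im λ · y`. [folklore] -/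
theorem imVec_cray (x y : EuclideanSpace ℝ ι) (l : ℂ) : imVec (cray x y l) = l.im • y := by
  ext i; simp

/-- The real part along the complex ray is `x + Re λ · y`. [folklore] -/
theorem reVec_cray (x y : EuclideanSpace ℝ ι) (l : ℂ) : reVec (cray x y l) = x + l.re • y := by
  ext i; simp

/-- For `y` in a cone `C` and `Im λ > 0` the complex ray lies in the tube over `C`. [folklore] -/
theorem cray_mem_tubeOver {C : Set (EuclideanSpace ℝ ι)}
    (hcone : ∀ t : ℝ, 0 < t → ∀ y ∈ C, t • y ∈ C) (x : EuclideanSpace ℝ ι)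
    {y : EuclideanSpace ℝ ι} (hy : y ∈ C) {l : ℂ} (hl : 0 < l.im) : cray x y l ∈ tubeOver C := by
  rw [mem_tubeOver_iff, imVec_cray]
  exact hcone _ hl y hy

/-- Splitting the parameter into real and imaginary part moves the base point along `y`:
`x + (s + it) y = (x + s y) + i t y`. [folklore] -/
theorem cray_re_add_im (x y : EuclideanSpace ℝ ι) (s t : ℝ) :
    cray x y (s + t * I) = cray (x + s • y) y ((t : ℂ) * I) := by
  funext i
  simp only [cray_apply, PiLp.add_apply, PiLp.smul_apply, smul_eq_mul, ofReal_add, ofReal_mul]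
  ring

/-- A point of the tube is the point `λ = i` of the complex ray through `Re z` in the direction
`Im z`. [folklore] -/
theorem cray_reVec_imVec (z : ι → ℂ) : cray (reVec z) (imVec z) I = z := by
  funext i
  simp [mul_comm I, re_add_im]

/-- The complex ray is jointly continuous in the base point and the parameter. [folklore] -/
theorem continuous_cray (y : EuclideanSpace ℝ ι) :
    Continuous fun p : EuclideanSpace ℝ ι × ℂ => cray p.1 y p.2 := by
  refine continuous_pi fun i => ?_
  simp only [cray_apply]
  exact (continuous_ofReal.comp ((PiLp.continuous_apply 2 _ i).comp continuous_fst)).add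
    (continuous_snd.mul continuous_const)

/-- The complex ray is continuous in the base point. [folklore] -/
theorem continuous_cray_left (y : EuclideanSpace ℝ ι) (l : ℂ) :
    Continuous fun x : EuclideanSpace ℝ ι => cray x y l :=
  (continuous_cray y).comp (continuous_id.prodMk continuous_const)

/-- The complex ray is affine in the parameter, with derivative the complexified direction.
[folklore] -/
theorem hasDerivAt_cray (x y : EuclideanSpace ℝ ι) (l : ℂ) :
    HasDerivAt (cray x y) (fun i => (y i : ℂ)) l := by
  rw [hasDerivAt_pi]
  intro i
  simpa using ((hasDerivAt_id l).mul_const (y i : ℂ)).const_add (x i : ℂ)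

/-! ### Bounds on compact families of rays -/

/-- A continuous function on the tube over a cone `C` is bounded on the rays `cray x y λ`,
`x ∈ S`, `λ ∈ T`, for `y ∈ C`, compact `S` and compact `T` in the open upper half-plane.
[folklore] -/
theorem exists_bound_cray {E : Type*} [SeminormedAddCommGroup E] {C : Set (EuclideanSpace ℝ ι)}
    (hcone : ∀ t : ℝ, 0 < t → ∀ y ∈ C, t • y ∈ C) {f : (ι → ℂ) → E}
    (hf : ContinuousOn f (tubeOver C)) {y : EuclideanSpace ℝ ι} (hy : y ∈ C)
    {S : Set (EuclideanSpace ℝ ι)} (hS : IsCompact S) {T : Set ℂ} (hT : IsCompact T)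
    (hT' : T ⊆ {l | 0 < l.im}) : ∃ M, ∀ x ∈ S, ∀ l ∈ T, ‖f (cray x y l)‖ ≤ M := by
  have hc : IsCompact ((fun p : EuclideanSpace ℝ ι × ℂ => cray p.1 y p.2) '' S ×ˢ T) :=
    (hS.prod hT).image (continuous_cray y)
  have hsub : (fun p : EuclideanSpace ℝ ι × ℂ => cray p.1 y p.2) '' S ×ˢ T ⊆ tubeOver C := by
    rintro _ ⟨p, hp, rfl⟩
    exact cray_mem_tubeOver hcone p.1 hy (hT' hp.2)
  obtain ⟨M, hM⟩ := hc.exists_bound_of_continuousOn (hf.mono hsub)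
  exact ⟨M, fun x hx l hl => hM _ ⟨(x, l), ⟨hx, hl⟩, rfl⟩⟩

/-! ### Holomorphy of the smeared ray function `λ ↦ ∫ F(x + λ y) φ(x) dx` -/

variable [Fintype ι]

/-- **Differentiation under the integral sign**: for `F` holomorphic on the tube over an open cone
`C`, `y ∈ C` and `φ` continuous of compact support, `λ ↦ ∫ F(x + λ y) φ(x) dx` is complex
differentiable on the upper half-plane (Hörmander, proof of Thm. 3.1.15: "an analytic function of
`w` when `0 < Im w`"). [cite: HormanderALPDO1, Thm 3.1.15] -/
theorem differentiableAt_integral_cray {C : Set (EuclideanSpace ℝ ι)} (hC : IsOpen C)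
    (hcone : ∀ t : ℝ, 0 < t → ∀ y ∈ C, t • y ∈ C) {F : (ι → ℂ) → ℂ}
    (hF : DifferentiableOn ℂ F (tubeOver C)) {y : EuclideanSpace ℝ ι} (hy : y ∈ C)
    {φ : EuclideanSpace ℝ ι → ℂ} (hφ : Continuous φ) (hφc : HasCompactSupport φ) {l₀ : ℂ}
    (hl₀ : 0 < l₀.im) :
    DifferentiableAt ℂ (fun l => ∫ x, F (cray x y l) * φ x) l₀ := by
  -- a compact neighbourhood of `l₀` inside the upper half-plane
  set s : Set ℂ := Metric.closedBall l₀ (l₀.im / 2) with hs_def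
  have hs_nhds : s ∈ 𝓝 l₀ := Metric.closedBall_mem_nhds l₀ (half_pos hl₀)
  have hs_im : s ⊆ {l | 0 < l.im} := by
    intro l hl
    have h1 : |l.im - l₀.im| ≤ l₀.im / 2 := by
      have := abs_im_le_norm (l - l₀)
      rw [sub_im] at this
      exact this.trans (mem_closedBall_iff_norm.1 hl)
    have h2 := (abs_le.1 h1).1
    show 0 < l.im
    linarith
  have hopen : IsOpen {l : ℂ | 0 < l.im} := isOpen_lt continuous_const continuous_im
  have htube : IsOpen (tubeOver C) := isOpen_tubeOver hC
  -- continuity of `F` and of its derivative along rays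
  have hFc : ∀ {l : ℂ}, 0 < l.im → Continuous fun x : EuclideanSpace ℝ ι => F (cray x y l) :=
    fun hl => hF.continuousOn.comp_continuous (continuous_cray_left y _)
      fun x => cray_mem_tubeOver hcone x hy hl
  have hF'c : ContinuousOn (fderiv ℂ F) (tubeOver C) :=
    Literature.Analysis.Complex.SCV.continuousOn_fderiv hF htube
  -- the bound on the derivative over the compact family of rays
  obtain ⟨M, hM⟩ := exists_bound_cray hcone hF'c hy hφc.isCompact
    (isCompact_closedBall l₀ (l₀.im / 2)) hs_im
  set F' : ℂ → EuclideanSpace ℝ ι → ℂ :=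
    fun l x => fderiv ℂ F (cray x y l) (fun i => (y i : ℂ)) * φ x
  have hres := hasDerivAt_integral_of_dominated_loc_of_deriv_le (μ := volume)
    (F := fun l x => F (cray x y l) * φ x) (F' := F') (x₀ := l₀)
    (bound := fun x => M * ‖(fun i => (y i : ℂ))‖ * ‖φ x‖) hs_nhds ?_ ?_ ?_ ?_ ?_ ?_
  · exact hres.2.differentiableAt
  · filter_upwards [hopen.mem_nhds hl₀] with l hl
    exact ((hFc hl).mul hφ).aestronglyMeasurable
  · exact ((hFc hl₀).mul hφ).integrable_of_hasCompactSupport hφc.mul_left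
  · refine Continuous.aestronglyMeasurable ?_
    refine Continuous.mul ?_ hφ
    have h1 : Continuous fun x : EuclideanSpace ℝ ι => fderiv ℂ F (cray x y l₀) :=
      hF'c.comp_continuous (continuous_cray_left y l₀) fun x => cray_mem_tubeOver hcone x hy hl₀
    exact h1.clm_apply continuous_const
  · refine Eventually.of_forall fun x l hl => ?_
    by_cases hx : x ∈ tsupport φ
    · calc ‖F' l x‖ ≤ ‖fderiv ℂ F (cray x y l)‖ * ‖(fun i => (y i : ℂ))‖ * ‖φ x‖ := by
            rw [norm_mul]
            exact mul_le_mul_of_nonneg_right (ContinuousLinearMap.le_opNorm _ _) (norm_nonneg _)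
        _ ≤ M * ‖(fun i => (y i : ℂ))‖ * ‖φ x‖ := by
            gcongr
            exact hM x hx l hl
    · have h0 : φ x = 0 := image_eq_zero_of_notMem_tsupport hx
      simp [F', h0]
  · exact (continuous_const.mul hφ.norm).integrable_of_hasCompactSupport hφc.norm.mul_left
  · refine Eventually.of_forall fun x l hl => ?_
    have hmem : cray x y l ∈ tubeOver C := cray_mem_tubeOver hcone x hy (hs_im hl)
    have hFd : HasFDerivAt F (fderiv ℂ F (cray x y l)) (cray x y l) :=
      (hF.differentiableAt (htube.mem_nhds hmem)).hasFDerivAt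
    exact (hFd.comp_hasDerivAt l (hasDerivAt_cray x y l)).mul_const (φ x)

/-- Continuity in `t > 0` of the ray integral `t ↦ ∫ F(x + ity) ψ(x) dx` for `ψ` continuous of
compact support (restriction of the holomorphic smeared ray function to the imaginary axis).
[folklore] -/
theorem continuousAt_integral_rayPoint {C : Set (EuclideanSpace ℝ ι)} (hC : IsOpen C)
    (hcone : ∀ t : ℝ, 0 < t → ∀ y ∈ C, t • y ∈ C) {F : (ι → ℂ) → ℂ}
    (hF : DifferentiableOn ℂ F (tubeOver C)) {y : EuclideanSpace ℝ ι} (hy : y ∈ C)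
    {ψ : EuclideanSpace ℝ ι → ℂ} (hψ : Continuous ψ) (hψc : HasCompactSupport ψ) {t : ℝ}
    (ht : 0 < t) :
    ContinuousAt (fun t : ℝ => ∫ x, F (rayPoint x y t) * ψ x) t := by
  have hIt : 0 < ((t : ℂ) * I).im := by simpa using ht
  have hd := differentiableAt_integral_cray hC hcone hF hy hψ hψc hIt
  have h := hd.continuousAt.comp (f := fun t : ℝ => (t : ℂ) * I)
    (by fun_prop : Continuous fun t : ℝ => (t : ℂ) * I).continuousAt
  exact h

end Literature.MathematicalPhysics.QuantumLattice
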